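import Literature.NumberTheory.Automorphic.OrbitalIntegralDoubleCosetUnfolding   -- ★ (h2): `conj_mem_iff_smul_mk_eq`, the general `K\G/C`-weighted unfolding
import Literature.MeasureTheory.Group.InvariantQuotientCompactSubgroup           -- ★ `lintegral_quotientMeasure_eq_inv_mul` (`μ_{G/C} = t(C)⁻¹ π_*ν`, `C` compact)
import Literature.NumberTheory.Automorphic.OrbitalMeasureCanonicalAtPoint        -- ★ D-S1g `IsCanonical.classOrbitalIntegral_mk_eq_orbitalIntegral'`, `compactCore_eq_univ`
import Literature.NumberTheory.Automorphic.ClosedCompactDecomposition            -- ★ `isInvInvariant_of_compactSpace` (compact groups are unimodular)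
import HarnessLib

/-!
# The unit orbital integral at an element with COMPACT centraliser is the number of fixed points on `G ⧸ K`:
# `O_γ(1_K) = #{x ∈ G⧸K | γ x = x} · vol(K) ∕ vol(C_G(γ))`
(Laumon, *Cohomology of Drinfeld modular varieties* I (1996), Lemma (5.3.2); Kottwitz's «counting fixed lattices»; Rogawski (1990), §4.9 p. 54,
Prop. 4.9.1 (b) — the unit fundamental lemma at an inert place is a comparison of such counts)

Topic `NumberTheory/Automorphic`; namespace `Literature.NumberTheory.Automorphic`.  THEOREMS ONLY (no definition, no named fact, no instance, no
notation, no `sorry`); the fixed-point set is Mathlib's `MulAction.fixedBy (G ⧸ K) γ = {x | γ • x = x}`.  Cell `pub/hodgecm-mathlib`, F0∕P3a, road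
«D-N7-inert» (letter N7 = ★ `UnitFundamentalLemmaExplicit`, inert half; A-p06 (g25)'s map 84809157 §3 (L2) ∕ §5 (D3)), brick «N7-inert-L2» (LEAD
F0P3a-plan (g9) WORD T8-8).  HC_CM is proved only modulo the printed citations until rung 0 closes; nothing printed is asserted here.

THE MATHEMATICS.  `G` locally compact, second countable, Hausdorff; `K ≤ G` compact open; `γ ∈ G` with centraliser `C = C_G(γ)` COMPACT (the elliptic
case); `ν` a two-sided Haar measure on `G`, `t` a (left, inversion-invariant) Haar measure on `C`, `ν ∕ t = quotientMeasure C t ν` the invariant measure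
on `G ⧸ C`.  Since `C` is compact, `ν ∕ t = t(C)⁻¹ · π_* ν` (★ `InvariantQuotientCompactSubgroup`), so
`∫⁻_{G⧸C} 1_K(y γ y⁻¹) d(ν∕t) = t(C)⁻¹ · ν{y | y γ y⁻¹ ∈ K}`.  The set `T = {y | y γ y⁻¹ ∈ K}` is the preimage of the `γ`-fixed points of `G ⧸ K` under
`θ : y ↦ y⁻¹K` (★ `conj_mem_iff_smul_mk_eq`: `y γ y⁻¹ ∈ K ↔ γ · y⁻¹K = y⁻¹K`), and the fibre of `θ` over `x₀K` is the right coset `K x₀⁻¹`, of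
mass `ν(K)`; hence **`ν(T) = #Fix_γ(G⧸K) · ν(K)`** exactly (in `[0, ∞]`, `#` the extended cardinal — no finiteness needed), and
**`O_γ(1_K) = #Fix_γ(G⧸K) · ν(K) ∕ t(C)`**, `= #Fix_γ(G⧸K)` for the canonical normalisation `ν(K) = 1`, `t(C) = t(compactCore C) = 1` (★ `IsCanonical`,
`compactCore C = C` for compact `C`).  The general (non-compact `C`) statement is ★ (h2) `lintegral_descConj_indicator_quotientMeasure_eq_tsum`:
a `K\G/C`-sum with weights `ν(K) ∕ t(C ∩ x⁻¹Kx)`; at compact `C` each weight is `ν(K)·[C : C ∩ x⁻¹Kx] ∕ t(C)` and the `C`-orbit of the fixed point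
`x⁻¹K` has `[C : C ∩ x⁻¹Kx]` points — this file cashes that index globally instead of coset by coset.  FINITENESS of the fixed-point set is
topological: at a CLOSED conjugacy class, `{yC | yγy⁻¹ ∈ K}` is compact (★ `isCompact_preimage_descConj_id_of_isClosed`), lifts into a compact
`A · C ⊆ G` (★ `exists_isCompact_image_mk_superset`, `C` compact), and its image in the DISCRETE space `G ⧸ K` is finite.

* §1 `setOf_conj_mem_eq_preimage_fixedBy`, `preimage_inv_mk_singleton_mk`, **`measure_preimage_inv_mk_eq_encard_mul`** (`ν(θ⁻¹ S) = #S · ν(K)` for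
  ANY `S ⊆ G ⧸ K`), `measure_setOf_conj_mem_eq_encard_mul`.
* §2 **`lintegral_descConj_indicator_quotientMeasure_eq_encard_mul`** (`C` compact: `∫⁻_{G⧸C} 1_K(yγy⁻¹) d(ν∕t) = #Fix · (ν K ∕ t univ)`),
  `…_eq_encard` (canonical: `= #Fix`).
* §3 **`finite_fixedBy_quotient_of_isClosed`** (closed class, `C` compact, `K` compact open ⇒ `Fix_γ(G⧸K)` finite; no measure, no unimodularity).
* §4 the real forms: **`orbitalIntegral_indicator_quotientMeasure_eq_card_mul`** (`O_γ^{ν∕t}(1_K) = Nat.card Fix · (ν K ∕ t univ).toReal`, given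
  finiteness), `…_eq_card` (canonical), `exists_isHaarMeasure_isInvInvariant_univ_eq_one` (the canonical `t` on a compact `C`), and the CLASS reading over
  ★ D-S1g: **`classOrbitalIntegral_indicator_eq_card_fixedBy`** — for `m` canonical for `(P, ν)` with `ν(K) = 1`, `P γ`, `C_G(γ)` compact and the class of `γ`
  closed: `classOrbitalIntegral m 1_K ⟦γ⟧ = Nat.card Fix_γ(G⧸K)`.

NOT here: the compact-MOD-CENTRE variant (`C ∕ Z` compact; weights `vol(Z K ∕ K)`), the lattice dictionary `G⧸K ≅ {self-dual lattices}` (L1), any count.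

## References
* [Laumon1995] G. Laumon, *Cohomology of Drinfeld Modular Varieties* I, Cambridge Stud. Adv. Math. 41 (1996), Lemma (5.3.2) p. 136, (4.3.11).
* [Rogawski1990] J. D. Rogawski, *Automorphic Representations of Unitary Groups in Three Variables*, Ann. of Math. Stud. 123 (1990), §4.9 p. 54,
  Prop. 4.9.1 (b) p. 55; §4.3 p. 43 (canonical measures).
* [Kottwitz1986] R. E. Kottwitz, *Base change for unit elements of Hecke algebras*, Compositio Math. 60 (1986), §3 (orbital integrals of units as
  lattice counts).
* [DeitmarEchterhoff2014] A. Deitmar, S. Echterhoff, *Principles of Harmonic Analysis*, 2nd ed. (2014), Thm. 1.5.3, Cor. 1.5.4, Lemma 9.3.3.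
-/

set_option autoImplicit false

noncomputable section

open MeasureTheory Measure Topology Filter Set
open scoped ENNReal NNReal Pointwise

namespace Literature.NumberTheory.Automorphic

open Literature.MeasureTheory.Group

/-! ## §1 `{y | y γ y⁻¹ ∈ K}` is the preimage of the fixed points; its Haar measure is `#Fix · ν(K)` -/

section Count

variable {G : Type*} [Group G] (γ : G) (K : Subgroup G)

/-- **`{y | y γ y⁻¹ ∈ K} = θ⁻¹ Fix_γ(G ⧸ K)`** for `θ y := y⁻¹K` (★ `conj_mem_iff_smul_mk_eq`). [cite: Laumon1995, Lemma (5.3.2) p. 136] -/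
theorem setOf_conj_mem_eq_preimage_fixedBy :
    {y : G | y * γ * y⁻¹ ∈ K} = (fun y : G => ((y⁻¹ : G) : G ⧸ K)) ⁻¹' MulAction.fixedBy (G ⧸ K) γ :=
  Set.ext fun y => by rw [mem_setOf_eq, mem_preimage, MulAction.mem_fixedBy, conj_mem_iff_smul_mk_eq]

/-- The fibre of `θ : y ↦ y⁻¹K` over `x₀K` is the right coset `K x₀⁻¹ = {y | y x₀ ∈ K}` (the coset bookkeeping of Laumon's count). [cite: Laumon1995, Lemma (5.3.2) p. 136] -/
theorem preimage_inv_mk_singleton_mk (x₀ : G) :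
    (fun y : G => ((y⁻¹ : G) : G ⧸ K)) ⁻¹' {((x₀ : G) : G ⧸ K)} = (fun y : G => y * x₀) ⁻¹' (K : Set G) :=
  Set.ext fun y => by
    rw [mem_preimage, mem_singleton_iff, QuotientGroup.eq, inv_inv, mem_preimage, SetLike.mem_coe]

variable [TopologicalSpace G] [IsTopologicalGroup G] [SecondCountableTopology G] [MeasurableSpace G] [BorelSpace G]
  (ν : Measure G) [ν.IsMulRightInvariant]

/-- **`ν(θ⁻¹ S) = #S · ν(K)`** for EVERY `S ⊆ G ⧸ K` (`K` open, `ν` right-invariant): the fibres of `θ : y ↦ y⁻¹K` are right cosets of `K`, of mass `ν(K)`,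
pairwise disjoint, open and non-empty (hence countably many, `G` being second countable); `#S = S.encard ∈ ℕ∞` (the measure count behind Laumon's
Lemma (5.3.2)). [cite: Laumon1995, Lemma (5.3.2) p. 136] [cite: DeitmarEchterhoff2014, Thm. 1.5.3] -/
theorem measure_preimage_inv_mk_eq_encard_mul (hK : IsOpen (K : Set G)) (S : Set (G ⧸ K)) :
    ν ((fun y : G => ((y⁻¹ : G) : G ⧸ K)) ⁻¹' S) = S.encard * ν K := by
  -- the fibres
  have hfib : ∀ x : G ⧸ K, ∃ x₀ : G, (x₀ : G ⧸ K) = x ∧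
      (fun y : G => ((y⁻¹ : G) : G ⧸ K)) ⁻¹' {x} = (fun y : G => y * x₀) ⁻¹' (K : Set G) := by
    intro x
    induction x using QuotientGroup.induction_on with
    | H x₀ => exact ⟨x₀, rfl, preimage_inv_mk_singleton_mk K x₀⟩
  have hopen : ∀ x : G ⧸ K, IsOpen ((fun y : G => ((y⁻¹ : G) : G ⧸ K)) ⁻¹' {x}) := fun x => by
    obtain ⟨x₀, -, h⟩ := hfib x
    rw [h]
    exact hK.preimage (continuous_id.mul continuous_const)
  have hne : ∀ x : G ⧸ K, ((fun y : G => ((y⁻¹ : G) : G ⧸ K)) ⁻¹' {x}).Nonempty := fun x => by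
    obtain ⟨x₀, -, h⟩ := hfib x
    rw [h]
    exact ⟨x₀⁻¹, by rw [mem_preimage, inv_mul_cancel]; exact K.one_mem⟩
  have hmeas : ∀ x : G ⧸ K, ν ((fun y : G => ((y⁻¹ : G) : G ⧸ K)) ⁻¹' {x}) = ν K := fun x => by
    obtain ⟨x₀, -, h⟩ := hfib x
    rw [h, measure_preimage_mul_right]
  have hdisj : S.PairwiseDisjoint fun x => (fun y : G => ((y⁻¹ : G) : G ⧸ K)) ⁻¹' {x} :=
    fun a _ b _ hab => (disjoint_singleton.2 hab).preimage _
  have hcount : S.Countable := hdisj.countable_of_isOpen (fun x _ => hopen x) fun x _ => hne x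
  rw [← biUnion_preimage_singleton, measure_biUnion hcount hdisj fun x _ => (hopen x).measurableSet]
  simp_rw [hmeas]
  exact ENNReal.tsum_set_const S (ν K)

/-- **`ν{y | y γ y⁻¹ ∈ K} = #Fix_γ(G ⧸ K) · ν(K)`** (`K` open, `ν` right-invariant, `#` = `Set.encard`). [cite: Laumon1995, Lemma (5.3.2) p. 136] -/
theorem measure_setOf_conj_mem_eq_encard_mul (hK : IsOpen (K : Set G)) :
    ν {y : G | y * γ * y⁻¹ ∈ K} = (MulAction.fixedBy (G ⧸ K) γ).encard * ν K := by
  rw [setOf_conj_mem_eq_preimage_fixedBy γ K, measure_preimage_inv_mk_eq_encard_mul K ν hK]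

end Count

/-! ## §2 `C_G(γ)` compact: `∫⁻_{G ⧸ C} 1_K(y γ y⁻¹) d(ν ∕ t) = #Fix · ν(K) ∕ t(C)` -/

section Compact

variable {G : Type*} [Group G] [TopologicalSpace G] [IsTopologicalGroup G] [LocallyCompactSpace G]
  [SecondCountableTopology G] [T2Space G] [MeasurableSpace G] [BorelSpace G]
  (γ : G) (K : Subgroup G)
  [MeasurableSpace (G ⧸ Subgroup.centralizer ({γ} : Set G))]
  [BorelSpace (G ⧸ Subgroup.centralizer ({γ} : Set G))]
  [hC : IsClosed ((Subgroup.centralizer ({γ} : Set G) : Subgroup G) : Set G)]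
  (t : Measure (Subgroup.centralizer ({γ} : Set G))) [t.IsMulLeftInvariant]
  [IsFiniteMeasureOnCompacts t] [t.IsOpenPosMeasure] [t.IsInvInvariant] [SFinite t]
  (ν : Measure G) [IsHaarMeasure ν] [ν.IsMulRightInvariant]
  [CompactSpace (Subgroup.centralizer ({γ} : Set G))]

/-- **THE UNIT ORBITAL INTEGRAL AT A COMPACT CENTRALISER IS A FIXED-POINT COUNT** (`[0, ∞]` form, no finiteness hypothesis): for `K` open,
`∫⁻_{G ⧸ C_G(γ)} 1_K(y γ y⁻¹) d(ν ∕ t) = #Fix_γ(G ⧸ K) · (ν(K) ∕ t(C_G(γ)))` — ★ `lintegral_quotientMeasure_eq_inv_mul` (`C` compact) and §1.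
[cite: Laumon1995, Lemma (5.3.2) p. 136] [cite: Rogawski1990, §4.9 p. 54] [cite: Kottwitz1986, §3] -/
theorem lintegral_descConj_indicator_quotientMeasure_eq_encard_mul (hK : IsOpen (K : Set G)) :
    ∫⁻ y, descConj γ (Subgroup.centralizer ({γ} : Set G))
        (fun _ hg => Subgroup.mem_centralizer_singleton_iff.1 hg)
          ((K : Set G).indicator (1 : G → ℝ≥0∞)) y
          ∂quotientMeasure (Subgroup.centralizer ({γ} : Set G)) t hC ν =
      (MulAction.fixedBy (G ⧸ K) γ).encard * (ν K / t Set.univ) := by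
  have hFm : Measurable (descConj γ (Subgroup.centralizer ({γ} : Set G))
      (fun _ hg => Subgroup.mem_centralizer_singleton_iff.1 hg) ((K : Set G).indicator (1 : G → ℝ≥0∞))) :=
    measurable_descConj γ _ _ (measurable_one.indicator hK.measurableSet)
  rw [lintegral_quotientMeasure_eq_inv_mul (Subgroup.centralizer ({γ} : Set G)) t ν hFm]
  have hT : MeasurableSet {y : G | y * γ * y⁻¹ ∈ K} :=
    (hK.preimage ((continuous_id.mul continuous_const).mul continuous_id.inv)).measurableSet
  have hfun : (fun g : G => descConj γ (Subgroup.centralizer ({γ} : Set G))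
      (fun _ hg => Subgroup.mem_centralizer_singleton_iff.1 hg) ((K : Set G).indicator (1 : G → ℝ≥0∞))
        (QuotientGroup.mk g)) = {y : G | y * γ * y⁻¹ ∈ K}.indicator 1 := by
    funext g
    rw [descConj_mk]
    by_cases hg : g * γ * g⁻¹ ∈ K
    · rw [indicator_of_mem (show g * γ * g⁻¹ ∈ (K : Set G) from hg), indicator_of_mem (show g ∈ {y : G | y * γ * y⁻¹ ∈ K} from hg)]
      rfl
    · rw [indicator_of_notMem (show g * γ * g⁻¹ ∉ (K : Set G) from hg),
        indicator_of_notMem (show g ∉ {y : G | y * γ * y⁻¹ ∈ K} from hg)]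
  rw [hfun, lintegral_indicator_one hT, measure_setOf_conj_mem_eq_encard_mul γ K ν hK, ENNReal.div_eq_inv_mul]
  ring

/-- **Canonical normalisation**: with `ν(K) = 1` and `t(C_G(γ)) = 1`, `∫⁻_{G ⧸ C_G(γ)} 1_K(y γ y⁻¹) d(ν ∕ t) = #Fix_γ(G ⧸ K)`.
[cite: Laumon1995, Lemma (5.3.2) p. 136] [cite: Rogawski1990, §4.3 p. 43; §4.9 p. 54] -/
theorem lintegral_descConj_indicator_quotientMeasure_eq_encard (hK : IsOpen (K : Set G)) (hν : ν K = 1)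
    (ht : t Set.univ = 1) :
    ∫⁻ y, descConj γ (Subgroup.centralizer ({γ} : Set G))
        (fun _ hg => Subgroup.mem_centralizer_singleton_iff.1 hg)
          ((K : Set G).indicator (1 : G → ℝ≥0∞)) y
          ∂quotientMeasure (Subgroup.centralizer ({γ} : Set G)) t hC ν =
      (MulAction.fixedBy (G ⧸ K) γ).encard := by
  rw [lintegral_descConj_indicator_quotientMeasure_eq_encard_mul γ K t ν hK, hν, ht, div_one, mul_one]

omit [IsTopologicalGroup G] [LocallyCompactSpace G] [SecondCountableTopology G] [T2Space G] [BorelSpace G]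
  [MeasurableSpace (G ⧸ Subgroup.centralizer ({γ} : Set G))] [BorelSpace (G ⧸ Subgroup.centralizer ({γ} : Set G))] hC
  [t.IsMulLeftInvariant] [IsFiniteMeasureOnCompacts t] [t.IsOpenPosMeasure] [t.IsInvInvariant] [SFinite t] in
/-- The canonical token: on a COMPACT centraliser `t(compactCore C_G(γ)) = t(C_G(γ))` (★ `compactCore_eq_univ`), so the `IsCanonical` normalisation
`t(compactCore) = 1` reads `t univ = 1`. [cite: Rogawski1990, §4.3 p. 43] -/
theorem apply_compactCore_centralizer_eq_apply_univ :
    t (compactCore (Subgroup.centralizer ({γ} : Set G))) = t Set.univ := by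
  rw [compactCore_eq_univ]

end Compact

/-! ## §3 Finiteness of the fixed-point set at a closed class with compact centraliser (topological) -/

section Finite

variable {G : Type*} [Group G] [TopologicalSpace G] [IsTopologicalGroup G] [LocallyCompactSpace G]
  [SecondCountableTopology G] [T2Space G] (γ : G) (K : Subgroup G)
  [CompactSpace (Subgroup.centralizer ({γ} : Set G))]

/-- **`Fix_γ(G ⧸ K)` IS FINITE** for `γ` with closed conjugacy class and compact centraliser and `K` compact open: `{yC | yγy⁻¹ ∈ K} ⊆ G ⧸ C` is compact
(★ `isCompact_preimage_descConj_id_of_isClosed`), lifts into a compact `A ⊆ G` (★ `exists_isCompact_image_mk_superset`), so `{y | yγy⁻¹ ∈ K} ⊆ A · C` is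
relatively compact and its image `Fix` under `y ↦ y⁻¹K` lies in a compact subset of the DISCRETE space `G ⧸ K`. No measure and no unimodularity is used.
[cite: DeitmarEchterhoff2014, Lemma 9.3.3] [cite: Laumon1995, Lemma (5.3.2) p. 136] -/
theorem finite_fixedBy_quotient_of_isClosed (hO : IsClosed {g | ∃ y : G, y * γ * y⁻¹ = g}) (hK : IsOpen (K : Set G))
    (hKc : IsCompact (K : Set G)) : (MulAction.fixedBy (G ⧸ K) γ).Finite := by
  haveI : DiscreteTopology (G ⧸ K) := QuotientGroup.discreteTopology hK
  -- the compact set `{yC | y γ y⁻¹ ∈ K}` and a compact lift `A`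
  have hB := isCompact_preimage_descConj_id_of_isClosed γ hO hKc
  obtain ⟨A, hA, hBA⟩ := exists_isCompact_image_mk_superset (Subgroup.centralizer ({γ} : Set G)) hB
  have hCc : IsCompact ((Subgroup.centralizer ({γ} : Set G) : Subgroup G) : Set G) :=
    isCompact_iff_compactSpace.2 inferInstance
  -- `Fix ⊆ θ(A · C)`
  have hsub : MulAction.fixedBy (G ⧸ K) γ ⊆
      (fun y : G => ((y⁻¹ : G) : G ⧸ K)) '' (A * ((Subgroup.centralizer ({γ} : Set G) : Subgroup G) : Set G)) := by
    intro x hx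
    induction x using QuotientGroup.induction_on with
    | H x₀ =>
      have hy : x₀⁻¹ * γ * x₀⁻¹⁻¹ ∈ K := (conj_mem_iff_smul_mk_eq γ K x₀⁻¹).2 (by rwa [inv_inv])
      have hmem : (QuotientGroup.mk (x₀⁻¹) : G ⧸ Subgroup.centralizer ({γ} : Set G)) ∈
          descConj γ (Subgroup.centralizer ({γ} : Set G)) (fun _ hg => Subgroup.mem_centralizer_singleton_iff.1 hg) id ⁻¹'
            (K : Set G) := by
        rw [mem_preimage, descConj_mk]
        exact hy
      obtain ⟨a, ha, hax⟩ := hBA hmem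
      have hc : a⁻¹ * x₀⁻¹ ∈ Subgroup.centralizer ({γ} : Set G) := QuotientGroup.eq.1 hax
      refine ⟨x₀⁻¹, ⟨a, ha, a⁻¹ * x₀⁻¹, hc, mul_inv_cancel_left a x₀⁻¹⟩, ?_⟩
      show (((x₀⁻¹)⁻¹ : G) : G ⧸ K) = (x₀ : G ⧸ K)
      rw [inv_inv]
  exact (((hA.mul hCc).image (QuotientGroup.continuous_mk.comp continuous_inv)).finite_of_discrete).subset hsub

end Finite

/-! ## §4 Real-valued forms and the class reading -/

section Real

variable {G : Type*} [Group G] [TopologicalSpace G] [IsTopologicalGroup G] [LocallyCompactSpace G]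
  [SecondCountableTopology G] [T2Space G] [MeasurableSpace G] [BorelSpace G]
  (γ : G) (K : Subgroup G)
  [MeasurableSpace (G ⧸ Subgroup.centralizer ({γ} : Set G))]
  [BorelSpace (G ⧸ Subgroup.centralizer ({γ} : Set G))]
  [hC : IsClosed ((Subgroup.centralizer ({γ} : Set G) : Subgroup G) : Set G)]
  (t : Measure (Subgroup.centralizer ({γ} : Set G))) [t.IsMulLeftInvariant]
  [IsFiniteMeasureOnCompacts t] [t.IsOpenPosMeasure] [t.IsInvInvariant] [SFinite t]
  (ν : Measure G) [IsHaarMeasure ν] [ν.IsMulRightInvariant]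
  [CompactSpace (Subgroup.centralizer ({γ} : Set G))]

/-- **`O_γ^{ν∕t}(1_K) = Nat.card Fix_γ(G ⧸ K) · (ν(K) ∕ t(C_G(γ))).toReal`** for the REAL indicator `1_K : G → ℝ`, `K` open, `C_G(γ)` compact, the fixed-point
set finite (e.g. ★ `finite_fixedBy_quotient_of_isClosed`). [cite: Laumon1995, Lemma (5.3.2) p. 136] [cite: Rogawski1990, §4.9 p. 54] [cite: Kottwitz1986, §3] -/
theorem orbitalIntegral_indicator_quotientMeasure_eq_card_mul (hK : IsOpen (K : Set G))
    (hfin : (MulAction.fixedBy (G ⧸ K) γ).Finite) :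
    orbitalIntegral γ ((K : Set G).indicator (1 : G → ℝ)) (quotientMeasure (Subgroup.centralizer ({γ} : Set G)) t hC ν) =
      (Nat.card (MulAction.fixedBy (G ⧸ K) γ) : ℝ) * (ν K / t Set.univ).toReal := by
  -- both sides are the (real) mass of the measurable set `{yC | y γ y⁻¹ ∈ K}`
  set B : Set (G ⧸ Subgroup.centralizer ({γ} : Set G)) :=
    descConj γ (Subgroup.centralizer ({γ} : Set G)) (fun _ hg => Subgroup.mem_centralizer_singleton_iff.1 hg) id ⁻¹' (K : Set G) with hB
  have hBm : MeasurableSet B :=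
    (hK.preimage (continuous_descConj γ _ _ continuous_id)).measurableSet
  have hR : descConj γ (Subgroup.centralizer ({γ} : Set G)) (fun _ hg => Subgroup.mem_centralizer_singleton_iff.1 hg)
      ((K : Set G).indicator (1 : G → ℝ)) = B.indicator 1 := by
    funext y
    induction y using QuotientGroup.induction_on with
    | H g =>
      rw [descConj_mk]
      by_cases hg : g * γ * g⁻¹ ∈ K
      · rw [indicator_of_mem (show g * γ * g⁻¹ ∈ (K : Set G) from hg),
          indicator_of_mem (show (QuotientGroup.mk g : G ⧸ _) ∈ B by rw [hB, mem_preimage, descConj_mk]; exact hg)]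
        rfl
      · rw [indicator_of_notMem (show g * γ * g⁻¹ ∉ (K : Set G) from hg),
          indicator_of_notMem (show (QuotientGroup.mk g : G ⧸ _) ∉ B by rw [hB, mem_preimage, descConj_mk]; exact hg)]
  have hE : descConj γ (Subgroup.centralizer ({γ} : Set G)) (fun _ hg => Subgroup.mem_centralizer_singleton_iff.1 hg)
      ((K : Set G).indicator (1 : G → ℝ≥0∞)) = B.indicator 1 := by
    funext y
    induction y using QuotientGroup.induction_on with
    | H g =>
      rw [descConj_mk]
      by_cases hg : g * γ * g⁻¹ ∈ K
      · rw [indicator_of_mem (show g * γ * g⁻¹ ∈ (K : Set G) from hg),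
          indicator_of_mem (show (QuotientGroup.mk g : G ⧸ _) ∈ B by rw [hB, mem_preimage, descConj_mk]; exact hg)]
        rfl
      · rw [indicator_of_notMem (show g * γ * g⁻¹ ∉ (K : Set G) from hg),
          indicator_of_notMem (show (QuotientGroup.mk g : G ⧸ _) ∉ B by rw [hB, mem_preimage, descConj_mk]; exact hg)]
  have hmass : quotientMeasure (Subgroup.centralizer ({γ} : Set G)) t hC ν B =
      (MulAction.fixedBy (G ⧸ K) γ).encard * (ν K / t Set.univ) := by
    rw [← lintegral_indicator_one hBm, ← hE]
    exact lintegral_descConj_indicator_quotientMeasure_eq_encard_mul γ K t ν hK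
  rw [orbitalIntegral_eq_integral_descConj, hR, integral_indicator_one hBm, Measure.real, hmass,
    ← hfin.cast_ncard_eq, ← Nat.card_coe_set_eq, ENat.toENNReal_coe, ENNReal.toReal_mul, ENNReal.toReal_natCast]

/-- **Canonical normalisation, real form**: `ν(K) = 1`, `t(C_G(γ)) = 1` ⇒ `O_γ^{ν∕t}(1_K) = Nat.card Fix_γ(G ⧸ K)`.
[cite: Laumon1995, Lemma (5.3.2) p. 136] [cite: Rogawski1990, §4.3 p. 43; §4.9 p. 54] -/
theorem orbitalIntegral_indicator_quotientMeasure_eq_card (hK : IsOpen (K : Set G))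
    (hfin : (MulAction.fixedBy (G ⧸ K) γ).Finite) (hν : ν K = 1) (ht : t Set.univ = 1) :
    orbitalIntegral γ ((K : Set G).indicator (1 : G → ℝ)) (quotientMeasure (Subgroup.centralizer ({γ} : Set G)) t hC ν) =
      (Nat.card (MulAction.fixedBy (G ⧸ K) γ) : ℝ) := by
  rw [orbitalIntegral_indicator_quotientMeasure_eq_card_mul γ K t ν hK hfin, hν, ht, div_one, ENNReal.toReal_one, mul_one]

end Real

section Canonical

variable {G : Type*} [Group G] [TopologicalSpace G] [IsTopologicalGroup G] [LocallyCompactSpace G]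
  [SecondCountableTopology G] [T2Space G] [MeasurableSpace G] [BorelSpace G]
  [∀ γ : G, MeasurableSpace (G ⧸ Subgroup.centralizer ({γ} : Set G))]
  [∀ γ : G, BorelSpace (G ⧸ Subgroup.centralizer ({γ} : Set G))]

omit [LocallyCompactSpace G] [∀ γ : G, MeasurableSpace (G ⧸ Subgroup.centralizer ({γ} : Set G))]
  [∀ γ : G, BorelSpace (G ⧸ Subgroup.centralizer ({γ} : Set G))] in
/-- **The canonical torus measure on a COMPACT centraliser**: a Haar measure `t` on `C_G(γ)`, inversion-invariant (★ `isInvInvariant_of_compactSpace`: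
compact groups are unimodular), with `t(C_G(γ)) = 1` — the `IsCanonical` normalisation at an elliptic `γ`. [cite: Rogawski1990, §4.3 p. 43] -/
theorem exists_isHaarMeasure_isInvInvariant_univ_eq_one (γ : G) [CompactSpace (Subgroup.centralizer ({γ} : Set G))] :
    ∃ t : Measure (Subgroup.centralizer ({γ} : Set G)), t.IsHaarMeasure ∧ t.IsInvInvariant ∧ t Set.univ = 1 := by
  haveI : BorelSpace (Subgroup.centralizer ({γ} : Set G)) := Subtype.borelSpace _
  let K₀ : TopologicalSpace.PositiveCompacts (Subgroup.centralizer ({γ} : Set G)) :=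
    ⟨⟨Set.univ, isCompact_univ⟩, by rw [interior_univ]; exact univ_nonempty⟩
  refine ⟨haarMeasure K₀, inferInstance, isInvInvariant_of_compactSpace _, ?_⟩
  exact haarMeasure_self

/-- **THE CLASS READING (D-S1g currency): `classOrbitalIntegral m 1_K ⟦γ⟧ = Nat.card Fix_γ(G ⧸ K)`** for a family `m` CANONICAL for `(P, ν)` (★
`OrbitalMeasureFamily.IsCanonical`: at every `P`-class the member is `ν ∕ t`, `t` the inversion-invariant Haar measure on the centraliser with mass one on
its compact core), `P` conjugation-invariant with `P γ`, `ν(K) = 1`, `C_G(γ)` COMPACT and the class of `γ` closed, `K` compact open — the shape in which the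
inert unit fundamental lemma compares `G`- and `H`-sides as lattice counts. [cite: Rogawski1990, §4.9 p. 54, Prop. 4.9.1 (b) p. 55] [cite: Laumon1995, Lemma (5.3.2) p. 136] [cite: Kottwitz1986, §3] -/
theorem classOrbitalIntegral_indicator_eq_card_fixedBy {P : G → Prop} (hP : ∀ g x : G, P g → P (x * g * x⁻¹))
    {ν : Measure G} [ν.IsHaarMeasure] [ν.IsMulRightInvariant] {m : OrbitalMeasureFamily G} (hm : m.IsCanonical P ν)
    {γ : G} (hγ : P γ) [CompactSpace (Subgroup.centralizer ({γ} : Set G))] (K : Subgroup G) (hK : IsOpen (K : Set G))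
    (hKc : IsCompact (K : Set G)) (hν : ν K = 1) (hO : IsClosed {g | ∃ y : G, y * γ * y⁻¹ = g}) :
    classOrbitalIntegral m ((K : Set G).indicator (1 : G → ℝ)) (ConjClasses.mk γ) =
      (Nat.card (MulAction.fixedBy (G ⧸ K) γ) : ℝ) := by
  haveI : BorelSpace (Subgroup.centralizer ({γ} : Set G)) := Subtype.borelSpace _
  let K₀ : TopologicalSpace.PositiveCompacts (Subgroup.centralizer ({γ} : Set G)) :=
    ⟨⟨Set.univ, isCompact_univ⟩, by rw [interior_univ]; exact univ_nonempty⟩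
  haveI : (haarMeasure K₀).IsInvInvariant := isInvInvariant_of_compactSpace _
  have h1 : haarMeasure K₀ Set.univ = 1 := haarMeasure_self
  have hcore : haarMeasure K₀ (compactCore (Subgroup.centralizer ({γ} : Set G))) = 1 := by
    rw [compactCore_eq_univ]; exact h1
  haveI : IsClosed ((Subgroup.centralizer ({γ} : Set G) : Subgroup G) : Set G) := isClosed_coe_centralizer_singleton γ
  rw [hm.classOrbitalIntegral_mk_eq_orbitalIntegral' hP hγ (haarMeasure K₀) hcore]
  exact orbitalIntegral_indicator_quotientMeasure_eq_card γ K (haarMeasure K₀) ν hK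
    (finite_fixedBy_quotient_of_isClosed γ K hO hK hKc) hν h1

end Canonical

end Literature.NumberTheory.Automorphic

end
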